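import Mathlib
import HarnessLib

/-!
# Slash-action bookkeeping for the C3 modular-form witness `F = G · M` (weight-0 block × invariant multiplier)
(route `ManinLocalTwoThree`, crux C3 `ManinPrimeToThreeAtNine` stmt-BirchSwinnertonDyer-22968; cell bsd-f2-manin, C3 LEAD p1 gen 15;
`--supports stmt-BirchSwinnertonDyer-22968`; route-independent, Mathlib only)

The witness of C3 skeleton v23/v24 `stub_kummerCubeRootModularFormWitness` is assembled (LEAD-MEMO v27 §1.2) as `F = G · M` with `G` a WEIGHT-0
block carrying a multiplier on `Γ₀(N)` (`G(γτ) = ρ_γ G(τ)`; p2 g17 `KummerCubeRootDictionary.exists_multiplier_gamma`, stabiliser clauses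
`forall_gamma_smul_eq_of_kummerPeriodTrivial` / `kummerPeriodTrivial_of_forall_gamma_smul_eq`) and `M` a weight-`k` INVARIANT multiplier
(`M ∣[k] γ = M`, on paper `P♮(j)^e Δ^k`).  This file is the slash-action algebra turning the block's clauses into the witness's clauses:

* `slash_zero_apply` — `(G ∣[0] A) τ = G (A • τ)`;
* `mul_slash_eq_smul` — `G(A•τ) = ρ G(τ)` ∀τ and `M ∣[k] A = M` ⟹ `(G·M) ∣[k] A = ρ • (G·M)`;
* `mul_slash_eq_self_of_forall_smul_eq` / `forall_smul_eq_of_mul_slash_eq_self` / `mul_slash_eq_self_iff` — the STABILISER of `G·M` under `A` is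
  that of `G` as soon as `G·M ≢ 0` (clauses 2–3 of the witness from p2's AN2-c);
* `norm_mul_slash_le_of_le` / `exists_growth_mul` — exponential growth at a cusp is inherited by the product (clause 4);
* `mdifferentiable_mul` — holomorphy of the product (clause 1, for a holomorphic block).

HONEST FRAMING.  Bookkeeping only; (AN2), C3, Manin's conjecture and BSD are NOT proved here.  No definitions, no sorry. [folklore]
-/

set_option autoImplicit false
-- lint-debt: the directory name repeats the summit name (sibling precedent `ManinLocalTwoThreeUDCGlue.lean`)
set_option linter.dupNamespace false

noncomputable section

open Complex UpperHalfPlane ModularForm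
open scoped Real Topology Manifold MatrixGroups ModularForm

namespace Summit.BirchSwinnertonDyer.BirchSwinnertonDyer.Theorems.ManinLocalTwoThree.WitnessSlashAlgebra

variable {G M : ℍ → ℂ} {k : ℤ} {A : SL(2, ℤ)} {ρ : ℂ}

/-! ## §1 Weight zero -/

/-- In weight `0` the slash action is composition with the Möbius action. [folklore] -/
theorem slash_zero_apply (G : ℍ → ℂ) (A : SL(2, ℤ)) (τ : ℍ) : (G ∣[(0 : ℤ)] A) τ = G (A • τ) := by
  rw [SL_slash_apply, neg_zero, zpow_zero, mul_one]

/-- `G ∣[0] A = G ↔ ∀ τ, G (A • τ) = G τ`. [folklore] -/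
theorem slash_zero_eq_self_iff (G : ℍ → ℂ) (A : SL(2, ℤ)) : G ∣[(0 : ℤ)] A = G ↔ ∀ τ : ℍ, G (A • τ) = G τ := by
  constructor
  · intro h τ
    rw [← slash_zero_apply G A τ, h]
  · intro h
    funext τ
    rw [slash_zero_apply, h]

/-! ## §2 The product `G · M` -/

/-- The product slashes factor by factor: `(G·M) ∣[k] A = (G ∣[0] A) · (M ∣[k] A)`. [folklore] -/
theorem mul_slash_eq (G M : ℍ → ℂ) (k : ℤ) (A : SL(2, ℤ)) :
    (G * M) ∣[k] A = G ∣[(0 : ℤ)] A * M ∣[k] A := by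
  have h := mul_slash_SL2 0 k A G M
  rwa [zero_add] at h

/-- **Multiplier transport.**  If `G(A•τ) = ρ·G(τ)` for all `τ` and `M ∣[k] A = M`, then `(G·M) ∣[k] A = ρ • (G·M)`. [folklore] -/
theorem mul_slash_eq_smul (hG : ∀ τ : ℍ, G (A • τ) = ρ * G τ) (hM : M ∣[k] A = M) :
    (G * M) ∣[k] A = ρ • (G * M) := by
  rw [mul_slash_eq, hM]
  funext τ
  rw [Pi.mul_apply, slash_zero_apply, hG, Pi.smul_apply, Pi.mul_apply, smul_eq_mul, mul_assoc]

/-- Invariance of the block gives invariance of the product (clause 2 of the witness). [folklore] -/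
theorem mul_slash_eq_self_of_forall_smul_eq (hG : ∀ τ : ℍ, G (A • τ) = G τ) (hM : M ∣[k] A = M) :
    (G * M) ∣[k] A = G * M := by
  have hG' : ∀ τ : ℍ, G (A • τ) = (1 : ℂ) * G τ := fun τ ↦ by rw [hG, one_mul]
  have h := mul_slash_eq_smul hG' hM
  rwa [one_smul] at h

/-- Conversely, if the block has SOME multiplier under `A`, the multiplier is `1` as soon as the invariant product does not vanish identically
(clause 3 of the witness). [folklore] -/
theorem forall_smul_eq_of_mul_slash_eq_self (hρ : ∃ ρ : ℂ, ∀ τ : ℍ, G (A • τ) = ρ * G τ) (hM : M ∣[k] A = M)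
    (hne : ∃ τ₀ : ℍ, G τ₀ * M τ₀ ≠ 0) (h : (G * M) ∣[k] A = G * M) : ∀ τ : ℍ, G (A • τ) = G τ := by
  obtain ⟨ρ, hG⟩ := hρ
  obtain ⟨τ₀, hτ₀⟩ := hne
  have hsm := mul_slash_eq_smul hG hM
  rw [h] at hsm
  have hρ1 : ρ = 1 := by
    have := congr_fun hsm τ₀
    rw [Pi.smul_apply, smul_eq_mul, Pi.mul_apply] at this
    -- `G τ₀ M τ₀ = ρ (G τ₀ M τ₀)` with `G τ₀ M τ₀ ≠ 0`
    have h1 : (ρ - 1) * (G τ₀ * M τ₀) = 0 := by rw [sub_mul, one_mul, ← this, sub_self]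
    rcases mul_eq_zero.mp h1 with h2 | h2
    · exact (sub_eq_zero.mp h2)
    · exact absurd h2 hτ₀
  intro τ
  rw [hG, hρ1, one_mul]

/-- **The stabiliser of `G·M` is the stabiliser of `G`** (under a multiplier for `G`, invariance of `M`, and `G·M ≢ 0`). [folklore] -/
theorem mul_slash_eq_self_iff (hρ : ∃ ρ : ℂ, ∀ τ : ℍ, G (A • τ) = ρ * G τ) (hM : M ∣[k] A = M)
    (hne : ∃ τ₀ : ℍ, G τ₀ * M τ₀ ≠ 0) : (G * M) ∣[k] A = G * M ↔ ∀ τ : ℍ, G (A • τ) = G τ :=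
  ⟨forall_smul_eq_of_mul_slash_eq_self hρ hM hne, fun h ↦ mul_slash_eq_self_of_forall_smul_eq h hM⟩

/-- The same packaged over a subgroup-indexed family (e.g. `γ : Gamma0 N` coerced to `SL(2, ℤ)`), with an abstract predicate `P γ` (on paper
`KummerPeriodTrivial D u γ`) known to be equivalent to invariance of the block: then `P γ ↔ (G·M) ∣[k] γ = G·M`. [folklore] -/
theorem stabiliser_transport {ι : Type*} (c : ι → SL(2, ℤ)) (P : ι → Prop)
    (hP : ∀ i, P i ↔ ∀ τ : ℍ, G (c i • τ) = G τ)
    (hρ : ∀ i, ∃ ρ : ℂ, ∀ τ : ℍ, G (c i • τ) = ρ * G τ) (hM : ∀ i, M ∣[k] (c i) = M)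
    (hne : ∃ τ₀ : ℍ, G τ₀ * M τ₀ ≠ 0) :
    (∀ i, P i → (G * M) ∣[k] (c i) = G * M) ∧ (∀ i, (G * M) ∣[k] (c i) = G * M → P i) :=
  ⟨fun i hi ↦ mul_slash_eq_self_of_forall_smul_eq ((hP i).mp hi) (hM i),
    fun i hi ↦ (hP i).mpr (forall_smul_eq_of_mul_slash_eq_self (hρ i) (hM i) hne hi)⟩

/-! ## §3 Growth at a cusp and holomorphy -/

/-- Exponential growth bounds multiply (clause 4 of the witness, cusp by cusp). [folklore] -/
theorem norm_mul_slash_le_of_le {g : SL(2, ℤ)} {C₁ C₂ A₁ A₂ m₁ m₂ : ℝ}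
    (hG : ∀ τ : ℍ, A₁ ≤ τ.im → ‖(G ∣[(0 : ℤ)] g) τ‖ ≤ C₁ * Real.exp (m₁ * τ.im))
    (hM : ∀ τ : ℍ, A₂ ≤ τ.im → ‖(M ∣[k] g) τ‖ ≤ C₂ * Real.exp (m₂ * τ.im))
    (τ : ℍ) (h₁ : A₁ ≤ τ.im) (h₂ : A₂ ≤ τ.im) :
    ‖((G * M) ∣[k] g) τ‖ ≤ C₁ * C₂ * Real.exp ((m₁ + m₂) * τ.im) := by
  rw [mul_slash_eq, Pi.mul_apply, norm_mul, add_mul, Real.exp_add]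
  have hC₁ : 0 ≤ C₁ * Real.exp (m₁ * τ.im) := le_trans (norm_nonneg _) (hG τ h₁)
  calc ‖(G ∣[(0 : ℤ)] g) τ‖ * ‖(M ∣[k] g) τ‖
      ≤ (C₁ * Real.exp (m₁ * τ.im)) * (C₂ * Real.exp (m₂ * τ.im)) :=
        mul_le_mul (hG τ h₁) (hM τ h₂) (norm_nonneg _) hC₁
    _ = C₁ * C₂ * (Real.exp (m₁ * τ.im) * Real.exp (m₂ * τ.im)) := by ring

/-- Existential packaging of the growth clause for the product at every cusp. [folklore] -/
theorem exists_growth_mul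
    (hG : ∀ g : SL(2, ℤ), ∃ C A m : ℝ, ∀ τ : ℍ, A ≤ τ.im → ‖(G ∣[(0 : ℤ)] g) τ‖ ≤ C * Real.exp (m * τ.im))
    (hM : ∀ g : SL(2, ℤ), ∃ C A m : ℝ, ∀ τ : ℍ, A ≤ τ.im → ‖(M ∣[k] g) τ‖ ≤ C * Real.exp (m * τ.im)) :
    ∀ g : SL(2, ℤ), ∃ C A m : ℝ, ∀ τ : ℍ, A ≤ τ.im → ‖((G * M) ∣[k] g) τ‖ ≤ C * Real.exp (m * τ.im) := by
  intro g
  obtain ⟨C₁, A₁, m₁, h₁⟩ := hG g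
  obtain ⟨C₂, A₂, m₂, h₂⟩ := hM g
  refine ⟨C₁ * C₂, max A₁ A₂, m₁ + m₂, fun τ hτ ↦ ?_⟩
  exact norm_mul_slash_le_of_le h₁ h₂ τ (le_trans (le_max_left _ _) hτ) (le_trans (le_max_right _ _) hτ)

/-- In weight `0` the growth clause for `G ∣[0] g` is a growth clause for `τ ↦ G (g • τ)`. [folklore] -/
theorem growth_zero_iff (g : SL(2, ℤ)) (C A m : ℝ) :
    (∀ τ : ℍ, A ≤ τ.im → ‖(G ∣[(0 : ℤ)] g) τ‖ ≤ C * Real.exp (m * τ.im)) ↔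
      ∀ τ : ℍ, A ≤ τ.im → ‖G (g • τ)‖ ≤ C * Real.exp (m * τ.im) := by
  simp only [slash_zero_apply]

/-- Holomorphy of the product (clause 1, when the block itself is holomorphic on `ℍ`). [folklore] -/
theorem mdifferentiable_mul (hG : MDifferentiable 𝓘(ℂ) 𝓘(ℂ) G) (hM : MDifferentiable 𝓘(ℂ) 𝓘(ℂ) M) :
    MDifferentiable 𝓘(ℂ) 𝓘(ℂ) (G * M) :=
  hG.mul hM

/-- A product that is nonzero somewhere: from a point where both factors are nonzero. [folklore] -/
theorem exists_mul_ne_zero (h : ∃ τ₀ : ℍ, G τ₀ ≠ 0 ∧ M τ₀ ≠ 0) : ∃ τ₀ : ℍ, G τ₀ * M τ₀ ≠ 0 := by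
  obtain ⟨τ₀, hG, hM⟩ := h
  exact ⟨τ₀, mul_ne_zero hG hM⟩

end Summit.BirchSwinnertonDyer.BirchSwinnertonDyer.Theorems.ManinLocalTwoThree.WitnessSlashAlgebra

end
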